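/-
Copyright: the b2b-balaban cell (near-miss cell 7), T⁴-continuum fan-out; row NE7b S4c (carrier debt F-ne7bp1g22-1(c) of
the COUNT route), part 3d, seat `t4-ne7b-formalise-leaf-02`.  Released under the licence of the surrounding project.
-/
import Summits.QuantumFields.BalabanUV.T4Continuum.Support.HistoryGenTimed
import Summits.QuantumFields.BalabanUV.T4Continuum.Support.HistoryTreeShapeLE

/-!
# Row NE7b S4c, part 3d: the tagged genealogy of a pedigree timed WITHOUT the renewal-at-reach clause is `ConsistentTLE`

Summits-side support leaf of the T⁴-continuum cell (rung (B)+1 on a FINITE torus only; NOT infinite volume, NOT the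
mass gap, NOT the Clay statement; NOT a proof of the spine estimate NE7b).  Row NE7b, route «COUNT», claim-table row
S4c (owner's ruling R-OWNER-22-6 (iii): «socket v3's member field becomes `ConsistentTLE` and the display `RenewAtReach`
DROPS»), supplier side.  [folklore] bookkeeping over the lineage's OWN typed carrier (leaf-09's `HistoryGen.Pedigree`
∕ `genT` ∕ `chainMerge`, row S3, and `HistoryBankingLE.ConsistentTLE`); nothing is quoted from print, nothing printed is
asserted; ONE parametrised predicate (`TimedLE`), no `def … : Prop` fact, no `[cite:]` tag.

WHY.  `HistoryGenTimed.Pedigree.Timed` carries the DISPLAYED clause `renew_reach : step c = (genT c′).reach W` (=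
`RenewAtReach`, finding F-1(c)) because the exit of record asked `ConsistentT`.  With the exit re-derived over
`ConsistentTLE` (`HistoryExitLE.relWeightBound_canon_of_irThresholdLE`, p208972), the supplier needs only
`step c ≤ (genT c′).reach W` — what print gives (physical readiness no later than the booked bound; the geometric
layer S1b∕S6-pt-3 derives it).  This file is leaf-09's `consistentT_chainMerge` ∕ `consistentT_genT` ∕ `wf_genT` with
`ConsistentT ↦ ConsistentTLE` and `Timed ↦ TimedLE`, proofs verbatim otherwise.

WHAT.  §1 `consistentTLE_chainMerge`.  §2 `structure TimedLE P K W` (= `Pedigree.Timed` with `renew_reach` relaxed to `≤`),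
`timedLE_of_timed`, **`consistentTLE_genT`**, **`wfLE_genT`** (well-formedness from `TimedLE` + forest + oldest-line-first,
via `HistoryTreeShapeLE.wf_of_consistentTLE_freshT_chrono` and leaf-09's `freshT_genT` ∕ `chronoC_genT`).  With these the
v3 socket's member fields `ConsistentTLE ∧ FreshT ∧ WF` (and `Chrono`, unchanged) are supplied under `TimedLE`; the
display `RenewAtReach` is no longer needed anywhere on the COUNT route.

HONEST.  NE7b NOT proved; spine 0/9.  HONEST DEPENDENCY (cell): continuum YM on T⁴ ⇐ BetaPertH ∧ nine spine
estimates (0/9 proved); BetaPertH ⇐ (D1) ∧ (D4) ∧ CAP+tail.  This file changes none of it.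
-/

open Finset
open Literature.MathematicalPhysics.QuantumFieldTheory.Balaban1983to89
open T4PersistenceDictionary T4PrintedShapeBanking T4TaggedShapeBanking T4BranchingRecordsGas
open Summit.QuantumFields.BalabanUV.T4Continuum.ZoneSkeleton
open Summit.QuantumFields.BalabanUV.T4Continuum.HistoryChrono
open Summit.QuantumFields.BalabanUV.T4Continuum.LateMergers
open Summit.QuantumFields.BalabanUV.T4Continuum.HistoryBankingLE
open Summit.QuantumFields.BalabanUV.T4Continuum.HistoryTreeShapeLE
open Summit.QuantumFields.BalabanUV.T4Continuum.HistoryGen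

namespace Summit.QuantumFields.BalabanUV.T4Continuum.HistoryGenTimedLE

/-! ## §1 Consistency of a chain at one step, no renewal-at-reach clause -/

section Chain

variable {ε : Type*} {sh : ε → PEv} {C : T4PrintedShapeBanking.Consts} {K : ℕ} {R : ℕ → ℕ}

/-- **A CHAIN OF `ConsistentTLE` MEMBERS ALIVE AT THE JOIN STEP IS `ConsistentTLE`** (= `HistoryGen.consistentT_chainMerge`
with `ConsistentT ↦ ConsistentTLE`; the merger clause of the two predicates is the same). [folklore] -/
theorem consistentTLE_chainMerge {s : ℕ} (hs : s ≤ K) : ∀ {G : Gen ε} {Hs : List (Gen ε)} {t : ℕ → ε},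
    ConsistentTLE sh C K R G → G.rootStep ≤ s → s < G.reach (dictWT sh R C.n₁) →
      (∀ H ∈ Hs, ConsistentTLE sh C K R H ∧ H.rootStep ≤ s ∧ s < H.reach (dictWT sh R C.n₁)) →
      (∀ i < Hs.length, (sh (t i)).kind = 2 ∧ (sh (t i)).step = s) → ConsistentTLE sh C K R (chainMerge G Hs t)
  | _, [], _, hG, _, _, _, _ => hG
  | G, H :: Hs, t, hG, hGr, hGl, hHs, ht => by
      rw [chainMerge_cons]
      obtain ⟨hH, hHr, hHl⟩ := hHs H List.mem_cons_self
      obtain ⟨hk, hst⟩ := ht 0 (by simp)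
      refine consistentTLE_chainMerge hs ?_ ?_ ?_ (fun H' hH' => hHs H' (List.mem_cons_of_mem _ hH'))
        fun i hi => ht (i + 1) (by simpa using hi)
      · simp only [ConsistentTLE]
        exact ⟨hG, hH, hk, hst ▸ hGr, hst ▸ hGl, hst ▸ hHr, hst ▸ hHl, hst ▸ hs⟩
      · rw [Gen.rootStep_merge]; exact (min_le_left _ _).trans hGr
      · rw [Gen.reach_merge]; exact hGl.trans_le ((le_max_left _ _).trans (Nat.le_add_right _ _))

end Chain

/-! ## §2 Timing on the pedigree without the renewal-at-reach clause -/

section TimedLE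

variable {α π : Type*} (P : Pedigree α π)

/-- **THE DISPLAYED TIMING FACTS, RENEWAL NO LATER THAN THE BOOKED REACH** — `HistoryGenTimed.Pedigree.Timed` VERBATIM
except `renew_reach : step c ≤ (genT c′).reach W` (a renewed old part is renewed no later than the booked reach of its
line: physical readiness precedes the booked bound).  A parametrised predicate on our data, not a fact. [folklore] -/
structure TimedLE (K : ℕ) (W : Lab α π → ℕ) : Prop where
  /-- every component is observed by the cutoff -/
  step_le : ∀ c, P.step c ≤ K
  /-- a renewed old part is a component of the previous step -/
  renew_step : ∀ c c', Part.old c' true ∈ P.parts c → P.step c' + 1 = P.step c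
  /-- … renewed no later than the booked reach of its line -/
  renew_reach : ∀ c c', Part.old c' true ∈ P.parts c → P.step c ≤ (P.genT c').reach W
  /-- an old part continued into a join is pending at the join step -/
  alive : ∀ c c', Part.old c' false ∈ P.parts c → 2 ≤ (P.parts c).length → P.step c < (P.genT c').reach W

variable {P} {C : T4PrintedShapeBanking.Consts} {K : ℕ} {R : ℕ → ℕ}

/-- renewal AT the reach is renewal no later than the reach: `Timed ⇒ TimedLE`. [folklore] -/
theorem timedLE_of_timed {W : Lab α π → ℕ} (hT : P.Timed K W) : TimedLE P K W where
  step_le := hT.step_le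
  renew_step := hT.renew_step
  renew_reach c c' h := (hT.renew_reach c c' h).le
  alive := hT.alive

/-- **THE TAGGED GENEALOGY OF A `TimedLE` PEDIGREE IS `ConsistentTLE`** for the shape map `Prod.fst` and the run's table
(= `HistoryGenTimed.Pedigree.consistentT_genT`, renewal clause relaxed). [folklore] -/
theorem consistentTLE_genT (hT : TimedLE P K (dictWT Prod.fst R C.n₁)) (c : α) :
    ConsistentTLE Prod.fst C K R (P.genT c) := by
  rw [Pedigree.genT_eq]
  -- every part genealogy is `ConsistentTLE`, born no later than `step c`; in a join every part is pending at `step c`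
  have hpart : ∀ (i : ℕ) (q : Part α π), q ∈ P.parts c →
      ConsistentTLE Prod.fst C K R (P.partGen c P.genT i q) ∧ (P.partGen c P.genT i q).rootStep ≤ P.step c ∧
        (2 ≤ (P.parts c).length → P.step c < (P.partGen c P.genT i q).reach (dictWT Prod.fst R C.n₁)) := by
    intro i q hq
    rcases q with ⟨c', r⟩ | ⟨d, x⟩
    · have hlt := P.step_lt c c' r hq
      have ih := consistentTLE_genT hT c'
      have hrs : (P.genT c').rootStep ≤ P.step c := (P.rootStep_genT_le c').trans hlt.le
      rcases r with _ | _
      · exact ⟨ih, hrs, fun h2 => hT.alive c c' hq h2⟩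
      · have hs := hT.renew_step c c' hq
        have hr := hT.renew_reach c c' hq
        refine ⟨?_, hrs, fun _ => ?_⟩
        · simp only [Pedigree.partGen, ConsistentTLE]
          exact ⟨ih, rfl, hs.symm, by rw [hs]; exact hr, by rw [hs]; exact hT.step_le c⟩
        · simp only [Pedigree.partGen, Gen.reach_renew, Pedigree.dictWT_fst, dictW_renew]
          omega
    · refine ⟨?_, le_of_eq (by rw [Pedigree.rootStep_partGen]), fun _ => ?_⟩
      · simp only [Pedigree.partGen, ConsistentTLE]
        exact ⟨rfl, rfl, hT.step_le c⟩
      · simp only [Pedigree.partGen, Gen.reach_born, Pedigree.dictWT_fst, dictW_birth]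
        omega
  unfold Pedigree.partsGen
  cases hps : P.parts c with
  | nil =>
      simp only [Pedigree.partsGenAux_nil, Pedigree.join, ConsistentTLE]
      exact ⟨rfl, rfl, hT.step_le c⟩
  | cons p ps =>
      rw [Pedigree.partsGenAux_cons]
      have hsub : ∀ q ∈ p :: ps, q ∈ P.parts c := fun q hq => by rw [hps]; exact hq
      cases ps with
      | nil => exact (hpart 0 p (hsub p List.mem_cons_self)).1
      | cons p' ps' =>
          have h2 : 2 ≤ (P.parts c).length := by rw [hps]; simp
          obtain ⟨hc0, hr0, hl0⟩ := hpart 0 p (hsub p List.mem_cons_self)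
          refine consistentTLE_chainMerge (hT.step_le c) hc0 hr0 (hl0 h2) (fun H hH => ?_) fun i _ => ⟨rfl, rfl⟩
          obtain ⟨k, q, hq, rfl⟩ := P.mem_partsGenAux hH
          obtain ⟨h1, h2', h3⟩ := hpart _ q (hsub q (List.mem_cons_of_mem _ hq))
          exact ⟨h1, h2', h3 h2⟩
termination_by P.step c
decreasing_by exact hlt

variable [DecidableEq α] [DecidableEq π]

/-- **… AND WELL FORMED** for the tagged table, on a forest listed oldest-line-first — the socket's triple
`ConsistentTLE ∧ FreshT ∧ WF` for every component from `TimedLE`, the forest property and the list order only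
(`HistoryTreeShapeLE.wf_of_consistentTLE_freshT_chrono` with leaf-09's `freshT_genT` ∕ `chronoC_genT`). [folklore] -/
theorem wfLE_genT (hF : ∀ c, P.Forest c) (hH : ∀ c, P.HeadOldest c) (hT : TimedLE P K (dictWT Prod.fst R C.n₁))
    (c : α) : (P.genT c).WF (dictWT Prod.fst R C.n₁) :=
  wf_of_consistentTLE_freshT_chrono (consistentTLE_genT hT c) (P.freshT_genT hF c) (Pedigree.chronoC_genT hH c)

end TimedLE

end Summit.QuantumFields.BalabanUV.T4Continuum.HistoryGenTimedLE
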